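import Literature.AlgebraicGeometry.HodgeTheory.WeilCharacterDecomposition
import Literature.AlgebraicGeometry.HodgeTheory.WeilClassesProducts
import Literature.AlgebraicGeometry.HodgeTheory.ChernCharacterBetti
import Literature.AlgebraicGeometry.HodgeTheory.AbelianVarietyEndomorphismsHOne
import HarnessLib

/-!
# Route `EightfoldBlochSeeds`, cruxes `BlochSeedsGeneric` (item stmt-HodgeConjecture-18880) / `BlochSeedDiscThree` (18882), line
# `pad4-cm-anchor`, stubs `stub_pad4_carrier` / `stub_rung_pad4_seedAt`: THE COORDINATES `(q, w)` OF A CARRIER CLASS `q·h_Kⁿ + w` ARE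
# WELL DEFINED — every `d ≥ 1`, every `(A, φ)` with `φ² = -d`, every `K`-symmetrised `h_K = d·c + φ^*c`

HONEST FRAMING. Nothing here proves either stub, either crux, rung H2, HC_AV or the Hodge conjecture; nothing is constructed.
UNCONDITIONAL `--supports` lemmas (no named fact as hypothesis, no definition, no Literature fact; D-0026). Census-neutral.

WHAT IS HERE (leafhand `leafhand-hodge-eightfoldblochseed-1-g1`). Both stubs of the `pad4-cm-anchor` lines name a class of the shape
`q·h_Kⁿ + w` (`h_K = d·e^*a + ψ^*e^*a` the `K`-symmetrised hyperplane class, `w` in the Weil plane `weilClassesOf P ψ n d`); a designer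
reads `(q, w)` off the class `cl(Z)` of a candidate carrier (the `d = 1` cell's «σ-check», `Cruxes/BlochSeedDiscOne/SeedCheckerPrimitive.lean`
§16.5 `ShapeAt.coords_unique`, there at `d = 1` in a frame and not importable from `Theorems/`). This file proves the `d`-UNIFORM,
frame-free form on any complex abelian variety `A` with `φ ≫ φ = -d`, `d ≥ 1`, from the tree's `K`-character calculus
(`iSup_pullbackEigenclasses_weilCharacter_eq_top`, `cupProduct_mem_pullbackEigenclasses`, `weilClassesOf_inf_nonWeil_eq_bot`):

* §1 `ksymm_mem_pullbackEigenclasses_one_one` — **`d·c + φ^*c` is `K`-balanced** (an eigenclass of the character `χ_{1,1}(x,y) = x² + dy²`)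
  for EVERY `c ∈ H²(A(ℂ); ℂ)`: in `H² = χ_{2,0} ⊕ χ_{1,1} ⊕ χ_{0,2}` the pull-back `φ^*` acts by `−d, d, −d`. In particular the stubs'
  `h_K = symH d ψ e a` is balanced for every `(e, a)`. `cupPowTwo_mem_pullbackEigenclasses_diag` — powers of a balanced class are
  eigenclasses of `χ_{j,j}`.
* §2 `carrierCoords_weil_unique`, `carrierCoords_unique` — **uniqueness of the coordinates**: for `n ≥ 1`, a balanced `h ∈ H²` and
  `w, w'` in the Weil plane, `q·hⁿ + w = q'·hⁿ + w'` forces `w = w'` and `(q − q')·hⁿ = 0` (`hⁿ ∈ χ_{n,n}` lies in the mixed part, which meets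
  the Weil plane in `0`); hence `q = q'` as soon as `hⁿ ≠ 0` (for a polarisation: `hⁿ ≠ 0` by `h^{2n} ≠ 0`). Adapted, with credit, from the
  crux workfile's `natCast_smul_add_map_mem_chi` / `cupPowTwo_mem_chi` / `ShapeAt.coords_unique` (seat `hsemireg-c5c8-1` g12–g13), made
  uniform in `d` and importable.

## References

[cite: vanGeemen1994HodgeAV, 4.8–4.9, Lemma 5.2 (1) and proof of Thm. 6.12] [cite: HatcherAT2002, §3.2 Prop. 3.10]
-/

noncomputable section

-- single-problem summit (Problem = Summit): the mandated namespace repeats `HodgeConjecture`.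
set_option linter.dupNamespace false

open CategoryTheory AlgebraicGeometry
open Literature.AlgebraicGeometry Literature.AlgebraicGeometry.Motives Literature.AlgebraicGeometry.HodgeTheory
open Literature.AlgebraicTopology.SingularHomology

namespace Summit.HodgeConjecture.HodgeConjecture.Theorems

variable {A : AbelianVariety ℂ} {φ : A ⟶ A} {d : ℕ}

/-! ## §1 `K`-symmetrised degree-2 classes are balanced; powers of balanced classes -/

section Balanced

/-- **`d·c + φ^*c` is `K`-balanced for every `c ∈ H²(A(ℂ); ℂ)`** (`φ ≫ φ = -d`, `d ≥ 1`): it is an eigenclass of the character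
`χ_{1,1}(x, y) = (x + iy√d)(x − iy√d)` of the test pull-backs `(x·𝟙 + y·φ)^*`. In `H² = χ_{2,0} ⊕ χ_{1,1} ⊕ χ_{0,2}`
(`iSup_pullbackEigenclasses_weilCharacter_eq_top`) the pull-back `φ^* = (0·𝟙 + 1·φ)^*` acts by `−d, d, −d`, so the `K`-symmetrisation kills
the outer summands and doubles the middle one. Adapted from `Cruxes/BlochSeedDiscOne/SeedCheckerPrimitive.lean` (`natCast_smul_add_map_mem_chi`).
[cite: vanGeemen1994HodgeAV, 4.9 and proof of Lemma 5.2 (1)] -/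
theorem ksymm_mem_pullbackEigenclasses_one_one (hd : 0 < d) (hφ : φ ≫ φ = -(d • 𝟙 A)) (c : complexBetti A.X 2) :
    (d : ℂ) • c + complexBetti.map φ.hom.hom.hom 2 c ∈
      pullbackEigenclasses A φ 2 (fun x y =>
        ((x : ℂ) + (y : ℂ) * Complex.I * (Real.sqrt d : ℂ)) ^ 1 * ((x : ℂ) - (y : ℂ) * Complex.I * (Real.sqrt d : ℂ)) ^ 1) := by
  have hc : c ∈ ⨆ (a : ℕ) (b : ℕ) (_ : a + b = 2) (_ : a ≤ A.dim) (_ : b ≤ A.dim),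
      pullbackEigenclasses A φ 2 (fun x y =>
        ((x : ℂ) + (y : ℂ) * Complex.I * (Real.sqrt d : ℂ)) ^ a * ((x : ℂ) - (y : ℂ) * Complex.I * (Real.sqrt d : ℂ)) ^ b) := by
    rw [iSup_pullbackEigenclasses_weilCharacter_eq_top hd hφ 2]
    trivial
  let S : complexBetti A.X 2 → Prop := fun c =>
    (d : ℂ) • c + complexBetti.map φ.hom.hom.hom 2 c ∈
      pullbackEigenclasses A φ 2 (fun x y =>
        ((x : ℂ) + (y : ℂ) * Complex.I * (Real.sqrt d : ℂ)) ^ 1 * ((x : ℂ) - (y : ℂ) * Complex.I * (Real.sqrt d : ℂ)) ^ 1)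
  have hzero : S 0 := by
    show (d : ℂ) • (0 : complexBetti A.X 2) + complexBetti.map φ.hom.hom.hom 2 0 ∈ _
    rw [smul_zero, map_zero, add_zero]
    exact Submodule.zero_mem _
  have hadd : ∀ u v : complexBetti A.X 2, S u → S v → S (u + v) := by
    intro u v hu hv
    show (d : ℂ) • (u + v) + complexBetti.map φ.hom.hom.hom 2 (u + v) ∈ _
    rw [smul_add, map_add, add_add_add_comm]
    exact Submodule.add_mem _ hu hv
  refine Submodule.iSup_induction _ (motive := S) hc (fun a c hc => ?_) hzero hadd
  refine Submodule.iSup_induction _ (motive := S) hc (fun b c hc => ?_) hzero hadd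
  refine Submodule.iSup_induction _ (motive := S) hc (fun hab c hc => ?_) hzero hadd
  refine Submodule.iSup_induction _ (motive := S) hc (fun _ c hc => ?_) hzero hadd
  refine Submodule.iSup_induction _ (motive := S) hc (fun _ c hc => ?_) hzero hadd
  -- `hc : c ∈ χ_{a,b}`, `a + b = 2`: the action of `φ^* = (0·𝟙 + 1·φ)^*` on `c`
  have hφc : complexBetti.map φ.hom.hom.hom 2 c =
      ((Complex.I * (Real.sqrt d : ℂ)) ^ a * (-(Complex.I * (Real.sqrt d : ℂ))) ^ b) • c := by
    have h01 := (mem_pullbackEigenclasses_iff.mp hc) 0 1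
    have e : ((0 : ℕ) • 𝟙 A + (1 : ℕ) • φ : A ⟶ A) = φ := by simp
    rw [e] at h01
    change complexBetti.map φ.hom.hom.hom 2 c = _ at h01
    rw [h01]
    congr 1
    push_cast
    ring
  have hsq : (Complex.I * (Real.sqrt d : ℂ)) ^ 2 = -(d : ℂ) := I_mul_sqrt_sq d
  show (d : ℂ) • c + complexBetti.map φ.hom.hom.hom 2 c ∈ _
  rcases Nat.lt_or_ge a 1 with ha | ha
  · obtain rfl : a = 0 := by omega
    obtain rfl : b = 2 := by omega
    rw [hφc, pow_zero, one_mul, neg_pow, hsq]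
    norm_num
  rcases Nat.lt_or_ge a 2 with ha2 | ha2
  · obtain rfl : a = 1 := by omega
    obtain rfl : b = 1 := by omega
    exact Submodule.add_mem _ (Submodule.smul_mem _ _ hc) (by rw [hφc]; exact Submodule.smul_mem _ _ hc)
  · obtain rfl : a = 2 := by omega
    obtain rfl : b = 0 := by omega
    rw [hφc, pow_zero, mul_one, hsq]
    norm_num

/-- **Powers of a balanced class**: `h ∈ χ_{1,1} ⟹ hʲ ∈ χ_{j,j}` (cup products of eigenclasses are eigenclasses of the product character,
the tree's `cupProduct_mem_pullbackEigenclasses`). Adapted from `Cruxes/BlochSeedDiscOne/SeedCheckerPrimitive.lean` (`cupPowTwo_mem_chi`).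
[cite: HatcherAT2002, §3.2 Prop. 3.10] [cite: vanGeemen1994HodgeAV, 4.8–4.9] -/
theorem cupPowTwo_mem_pullbackEigenclasses_diag {h : complexBetti A.X 2}
    (hh : h ∈ pullbackEigenclasses A φ 2 (fun x y =>
      ((x : ℂ) + (y : ℂ) * Complex.I * (Real.sqrt d : ℂ)) ^ 1 * ((x : ℂ) - (y : ℂ) * Complex.I * (Real.sqrt d : ℂ)) ^ 1))
    (j : ℕ) :
    cupPowTwo h j ∈ pullbackEigenclasses A φ (2 * j) (fun x y =>
      ((x : ℂ) + (y : ℂ) * Complex.I * (Real.sqrt d : ℂ)) ^ j * ((x : ℂ) - (y : ℂ) * Complex.I * (Real.sqrt d : ℂ)) ^ j) := by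
  induction j with
  | zero =>
    rw [mem_pullbackEigenclasses_iff]
    intro x y
    rw [cupPowTwo_zero, pow_zero, pow_zero, one_mul, one_smul]
    exact singularCohomology.map_one _
  | succ j ih =>
    rw [cupPowTwo_succ]
    have h' := cupProduct_mem_pullbackEigenclasses (two_mul_add_two j) ih hh
    have e : (fun x y : ℕ =>
        ((x : ℂ) + (y : ℂ) * Complex.I * (Real.sqrt d : ℂ)) ^ j * ((x : ℂ) - (y : ℂ) * Complex.I * (Real.sqrt d : ℂ)) ^ j *
          (((x : ℂ) + (y : ℂ) * Complex.I * (Real.sqrt d : ℂ)) ^ 1 * ((x : ℂ) - (y : ℂ) * Complex.I * (Real.sqrt d : ℂ)) ^ 1)) =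
        (fun x y : ℕ =>
          ((x : ℂ) + (y : ℂ) * Complex.I * (Real.sqrt d : ℂ)) ^ (j + 1) *
            ((x : ℂ) - (y : ℂ) * Complex.I * (Real.sqrt d : ℂ)) ^ (j + 1)) := by
      funext x y
      ring
    rw [e] at h'
    exact h'

/-- **`hⁿ` lies in the mixed (non-Weil) part of `H²ⁿ`** for a balanced `h` and `n ≥ 1`: `χ_{n,n}` is one of the summands `χ_{a,b}`,
`a + b = 2n`, `a, b ≥ 1`, whose span meets the Weil plane in `0` (`weilClassesOf_inf_nonWeil_eq_bot`). [cite: vanGeemen1994HodgeAV, proof of Thm. 6.12] -/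
theorem cupPowTwo_mem_nonWeil {h : complexBetti A.X 2}
    (hh : h ∈ pullbackEigenclasses A φ 2 (fun x y =>
      ((x : ℂ) + (y : ℂ) * Complex.I * (Real.sqrt d : ℂ)) ^ 1 * ((x : ℂ) - (y : ℂ) * Complex.I * (Real.sqrt d : ℂ)) ^ 1))
    {n : ℕ} (hn : 0 < n) :
    cupPowTwo h n ∈ ⨆ (a : ℕ) (b : ℕ) (_ : a + b = 2 * n) (_ : 0 < a) (_ : 0 < b),
      pullbackEigenclasses A φ (2 * n) (fun x y =>
        ((x : ℂ) + (y : ℂ) * Complex.I * (Real.sqrt d : ℂ)) ^ a * ((x : ℂ) - (y : ℂ) * Complex.I * (Real.sqrt d : ℂ)) ^ b) :=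
  Submodule.mem_iSup_of_mem n (Submodule.mem_iSup_of_mem n (Submodule.mem_iSup_of_mem (by omega)
    (Submodule.mem_iSup_of_mem hn (Submodule.mem_iSup_of_mem hn (cupPowTwo_mem_pullbackEigenclasses_diag hh n)))))

end Balanced

/-! ## §2 Uniqueness of the coordinates `(q, w)` of `q·hⁿ + w` -/

section Coordinates

/-- **The Weil coordinate is unique**: for a balanced `h ∈ H²(A(ℂ); ℂ)` (`h ∈ χ_{1,1}`; e.g. every `d·c + φ^*c`), `n, d ≥ 1`, complex
scalars `q, q'` and `w, w'` in the Weil plane `weilClassesOf A φ n d`, `q·hⁿ + w = q'·hⁿ + w'` forces `w = w'` AND `(q − q')·hⁿ = 0`: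
the difference `(q − q')·hⁿ = w' − w` lies in the mixed part (`cupPowTwo_mem_nonWeil`) and in the Weil plane, which meet in `0`
(`weilClassesOf_inf_nonWeil_eq_bot`). [cite: vanGeemen1994HodgeAV, proof of Thm. 6.12] -/
theorem carrierCoords_weil_unique (hd : 0 < d) {n : ℕ} (hn : 0 < n) {h : complexBetti A.X 2}
    (hh : h ∈ pullbackEigenclasses A φ 2 (fun x y =>
      ((x : ℂ) + (y : ℂ) * Complex.I * (Real.sqrt d : ℂ)) ^ 1 * ((x : ℂ) - (y : ℂ) * Complex.I * (Real.sqrt d : ℂ)) ^ 1))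
    {q q' : ℂ} {w w' : complexBetti A.X (2 * n)} (hw : w ∈ weilClassesOf A φ n d) (hw' : w' ∈ weilClassesOf A φ n d)
    (heq : q • cupPowTwo h n + w = q' • cupPowTwo h n + w') :
    w = w' ∧ (q - q') • cupPowTwo h n = 0 := by
  have hdiff : (q - q') • cupPowTwo h n = w' - w := by
    rw [sub_smul]
    exact sub_eq_sub_iff_add_eq_add.mpr (by rw [heq, add_comm])
  have hmixed := Submodule.smul_mem _ (q - q') (cupPowTwo_mem_nonWeil hh hn)
  have hweil : (q - q') • cupPowTwo h n ∈ weilClassesOf A φ n d := by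
    rw [hdiff]
    exact Submodule.sub_mem _ hw' hw
  have h0 : (q - q') • cupPowTwo h n = 0 := by
    have hmem : (q - q') • cupPowTwo h n ∈ weilClassesOf A φ n d ⊓ _ := ⟨hweil, hmixed⟩
    rw [weilClassesOf_inf_nonWeil_eq_bot hn hd φ] at hmem
    exact (Submodule.mem_bot ℂ).mp hmem
  refine ⟨?_, h0⟩
  rw [h0] at hdiff
  exact (sub_eq_zero.mp hdiff.symm).symm

/-- **Both coordinates are unique when `hⁿ ≠ 0`**: under the hypotheses of `carrierCoords_weil_unique` and `hⁿ ≠ 0` (for a polarisation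
class this follows from `h^{2n} ≠ 0`), `q·hⁿ + w = q'·hⁿ + w'` forces `q = q'` and `w = w'` — so the pair `(q, w)` read off the class of a
candidate carrier in `stub_pad4_carrier` / `stub_rung_pad4_seedAt` is well defined, for every `d`. [cite: vanGeemen1994HodgeAV, proof of Thm. 6.12] -/
theorem carrierCoords_unique (hd : 0 < d) {n : ℕ} (hn : 0 < n) {h : complexBetti A.X 2}
    (hh : h ∈ pullbackEigenclasses A φ 2 (fun x y =>
      ((x : ℂ) + (y : ℂ) * Complex.I * (Real.sqrt d : ℂ)) ^ 1 * ((x : ℂ) - (y : ℂ) * Complex.I * (Real.sqrt d : ℂ)) ^ 1))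
    (hh0 : cupPowTwo h n ≠ 0)
    {q q' : ℂ} {w w' : complexBetti A.X (2 * n)} (hw : w ∈ weilClassesOf A φ n d) (hw' : w' ∈ weilClassesOf A φ n d)
    (heq : q • cupPowTwo h n + w = q' • cupPowTwo h n + w') :
    q = q' ∧ w = w' := by
  obtain ⟨hww, hq⟩ := carrierCoords_weil_unique hd hn hh hw hw' heq
  exact ⟨sub_eq_zero.mp ((smul_eq_zero.mp hq).resolve_right hh0), hww⟩

/-- **The stubs' instance**: for the `K`-symmetrised class `h_K = d·c + φ^*c` of ANY `c ∈ H²` (in the stubs: `c = e^*a`), `n, d ≥ 1`, and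
`w, w'` rational or not in the Weil plane, `q·h_Kⁿ + w = q'·h_Kⁿ + w'` with `q, q' ∈ ℚ` forces `w = w'`, and `q = q'` if `h_Kⁿ ≠ 0`.
[cite: vanGeemen1994HodgeAV, Lemma 5.2 (1) and proof of Thm. 6.12] -/
theorem carrierCoords_unique_ksymm (hd : 0 < d) (hφ : φ ≫ φ = -(d • 𝟙 A)) {n : ℕ} (hn : 0 < n) (c : complexBetti A.X 2)
    {q q' : ℚ} {w w' : complexBetti A.X (2 * n)} (hw : w ∈ weilClassesOf A φ n d) (hw' : w' ∈ weilClassesOf A φ n d)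
    (heq : ((q : ℚ) : ℂ) • cupPowTwo ((d : ℂ) • c + complexBetti.map φ.hom.hom.hom 2 c) n + w =
      ((q' : ℚ) : ℂ) • cupPowTwo ((d : ℂ) • c + complexBetti.map φ.hom.hom.hom 2 c) n + w') :
    w = w' ∧ (cupPowTwo ((d : ℂ) • c + complexBetti.map φ.hom.hom.hom 2 c) n ≠ 0 → q = q') := by
  have hh := ksymm_mem_pullbackEigenclasses_one_one hd hφ c
  refine ⟨(carrierCoords_weil_unique hd hn hh hw hw' heq).1, fun hh0 => ?_⟩
  exact_mod_cast (carrierCoords_unique hd hn hh hh0 hw hw' heq).1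

end Coordinates

end Summit.HodgeConjecture.HodgeConjecture.Theorems

end
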